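import Summits.QuantumFields.YangMills.Theorems.FluctuationComparisonRegPrIntLS2BetaChartReadDescentOntoT3
import Literature.MathematicalPhysics.QuantumFieldTheory.Balaban1983to89.B10Eq18SigmaSU2Haar
import HarnessLib

/-!
# S2β · (SUBM-m) (s1)+(s2) IN THE DOOR'S OWN SOURCE CHART: the charted descent `ζ ↦ Λ(D_{J,K}(expPoint(ζ)•U₀)(B)·D_{J,K}(U₀)(B)⁻¹)` of the right-invariant QUATERNIONIC
# chart `ζ ↦ expPoint(ζ ℓ)·U₀ ℓ` (✓`…S2BetaCritMOfSubmersion`'s `Mc`-shape) is strictly differentiable at `0` with ONTO derivative for every good history — the bridge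
# `expPoint x = Θ(iΣσ_a(rev x)^a)` to pub-ymgap N09's log chart (lit `B10Eq18SigmaSU2Haar.coe_expPoint_rev` + `B13HaarSigmaJacobian.su2Coordₗ`, BY NAME)

Cell `ym3-torus` (YM ladder rung R3 = continuum `SU(2)` Yang–Mills on the three-torus at fixed lattice data — a RUNG: NOT d = 4, NOT infinite volume, NOT a mass gap,
NOT Clay).  Width seat `ym3-torus-px13` (gen 25); crux `stmt-QuantumFields-20520` (`…Theses.UnitScaleTilt.FluctuationComparisonRegPrIntL`), LINE g18-1 S2β, organ GAP♯∘
⟸ (D♮) ∧ (F♮) ⟸ «CRIT♮» ⟸ «MULT♭» = CRIT-m♮ ∧ MULT♮ ∧ AVG₂♭; CRIT-m♮ ⟸ (SUBM-m) = (s1) ∧ (s2) ∧ (s3) (px5 g22 instance door ✓`…S2BetaCritMOfSubmersion` — `Mc : (PBond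
(F.P K) 0 → EuclideanSpace ℝ (Fin 3)) → Y`, `hMc : HasStrictFDerivAt Mc DM 0`, `hsurj : Function.Surjective DM`; (s3) + assembly px5).  THIS FILE (FILE C of three):
(s1) ∧ (s2) for the door's `Mc` with `Y := PBond (F.P J) 0 → 𝔰𝔲(2)` (N09's log chart at the coarse end), `DM := fderiv ℝ Mc 0` — `--kind proof --supports
stmt-QuantumFields-20520 --as helper`, count-neutral, DEFINITION-FREE (0 `def`, 0 `instance`, 0 `notation`, 0 `sorry`).

OBJECTS (CONSUMED BY NAME).  lit `T4HaarSU2ExpChart.expPoint x = quatToSU2 (exp (imQuat x))`, lit `B10Eq18SigmaSU2.{su2Coord, su2Coord_injective, exists_su2Coord_eq,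
su2Coord_mem_su}` (`x ↦ iΣ_a x^aσ_a`), lit `B13HaarSigmaJacobian.su2Coordₗ` (the same as a linear map), lit `B10Eq18SigmaSU2Haar.{rev, rev_rev, coe_expPoint_rev}`
(`↑(expPoint (rev A)) = exp (su2Coord A)`), lit `CompactKillingForm.mem_su_iff`, `mem_specialUnitaryLogChart_lie`, ✓FILE B `…S2BetaChartReadDescentOntoT3` (log-chart edition
at the organ).  The coordinate `ℝ³ ≅ 𝔰𝔲(2)` `x ↦ ⟨su2Coord (rev x), _⟩` is NEVER defined: it appears as a lambda in statements and as a local `ContinuousLinearEquiv` inside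
proofs (the pattern of lit `B10Eq18SigmaSU2Chart`, whose `su2Coord_mem_lie`∕`expChart_pauli` are the un-reversed forms of §1 — that module is not imported here).

WHAT IS PROVED (sorry-free).
* §1 `su2Coord_rev_mem_lie`; `expPoint_eq_expChart` — `expPoint x = Θ⟨su2Coord (rev x), _⟩`; `piExpPoint_translate_eq` — field level: `(ℓ ↦ expPoint(ζ ℓ)·U₀ ℓ) =
  (b ↦ Θ(⟨su2Coord (rev (ζ b))⟩)·U₀ b)`; `exists_coordEquiv` — `∃ E : (PBond P j → ℝ³) ≃L[ℝ] (PBond P j → 𝔰𝔲(2)), ∀ ζ b, E ζ b = ⟨su2Coord (rev (ζ b)), _⟩`.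
* §2 ★★★`hasStrictFDerivAt_chartRead_descendTo_expPoint` — for `U₀ ∈ histGood F ℰp θ K J` under FILE B's displayed numerics: **`HasStrictFDerivAt Mc (fderiv ℝ Mc 0) 0 ∧
  Function.Surjective (fderiv ℝ Mc 0)`** for `Mc ζ B := Λ(descendTo F ℰp J K hJK (ℓ ↦ expPoint (ζ ℓ)·U₀ ℓ) B · (descendTo F ℰp J K hJK U₀ B)⁻¹)`; `contDiffAt_chartRead_descendTo_expPoint`
  ((i) `C^∞`, guard only); `chartRead_descendTo_expPoint_eq_comp` (`Mc = Mc_log ∘ E`); `chartRead_descendTo_expPoint_apply_zero`.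
* §3 the door's two topological inputs (✓p823740 `exists_multiplier_of_chart`'s `hcont`, `hO`∕`hχ`): ★`continuousAt_descendTo_expPoint` (the RAW charted descent
  `ζ ↦ D_{J,K}(expPoint(ζ)•U₀)` is continuous at `0` under the guard) and ★`injOn_relLogChart` ∕ `relLogChart_window_mem_nhds` (the target chart `W ↦ (B ↦ Λ(W B·(V B)⁻¹))` is
  injective on the window `{W | ∀ B, ‖↑(W B·(V B)⁻¹) − 1‖ < innerRadius}`, a neighbourhood of `V`; any `P`, `SU(N)`).

HONEST.  A coordinate change (linear bijection per bond) over FILE B; NO estimate of Bałaban's; `DM` not computed beyond «`fderiv` of a named map» (RINV-cov ∕ MULT♮ ∕ AVG₂♭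
untouched); (s3) and the assembly into CRIT-m♮ are px5 g22's; CRIT-m♮, «CRIT♮», (D♮)∕(F♮), GAP♯∘ (registry UNTOUCHED), the five REGISTERED stubs, S2β, crux 20520, 19936, 19200
and `YM3TorusSU2` are NOT proved; no summit statement is proved by a helper; rung R3 = SU(2) YM₃ on T³ at fixed lattice data — NOT d = 4, NOT infinite volume, NOT a mass
gap, NOT Clay; the Yang–Mills mass gap is NOT proved.  Axioms standard.

References: T. Bałaban, CMP **109** (1987) 249–301 [Balaban1987RG1] ((0.4), (0.8), (0.11) p.253); CMP **102** (1985) 255–275 [Balaban1985UV3] (p.260: the chart `A ↦ exp iA`;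
(7) p.257); CMP **102** (1985) 277–309 [Balaban1985Variational] ((3) p.278, (26) p.282, (44) p.285: the constraint and the expansion about the background).
-/

set_option autoImplicit false

noncomputable section

open scoped Matrix.Norms.L2Operator Topology
open Filter Set Function

namespace Summit.QuantumFields.YangMills.Theorems.FluctuationComparisonRegPrIntLS2BetaChartReadDescentOntoExpPoint

open Literature.MathematicalPhysics.QuantumFieldTheory.Balaban1983to89
open Literature.MathematicalPhysics.QuantumFieldTheory.Balaban1983to89.HaarExponentialChart
open Literature.MathematicalPhysics.QuantumFieldTheory.Balaban1983to89.HaarExponentialChart.IsChartRep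
open Literature.MathematicalPhysics.QuantumFieldTheory.Balaban1983to89.BlockAveraging (Small Idx avgFun loopHol blockAvg blockAvg_avg)
open Literature.MathematicalPhysics.QuantumFieldTheory.Balaban1983to89.ExpMeanLog (expMeanLogSU deltaSU)
open Literature.MathematicalPhysics.QuantumFieldTheory.Balaban1983to89.Node00
open Literature.MathematicalPhysics.QuantumFieldTheory.Balaban1983to89.T3ContinuumYM3Torus
open Literature.MathematicalPhysics.QuantumFieldTheory.Balaban1983to89.T3UnitLawDensityEML (ℰp)
open Literature.MathematicalPhysics.QuantumFieldTheory.Balaban1983to89.T3UnitScaleTilt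
open Literature.MathematicalPhysics.QuantumFieldTheory.Balaban1983to89.T3TiltDescent
open Literature.MathematicalPhysics.QuantumFieldTheory.Balaban1983to89.T4HaarSU2ExpChart (expPoint expPoint_zero)
open Literature.MathematicalPhysics.QuantumFieldTheory.Balaban1983to89.B10Eq18SigmaSU2 (su2Coord su2Coord_injective exists_su2Coord_eq su2Coord_mem_su)
open Literature.MathematicalPhysics.QuantumFieldTheory.Balaban1983to89.B13HaarSigmaJacobian (su2Coordₗ su2Coordₗ_apply_coe)
open Literature.MathematicalPhysics.QuantumFieldTheory.Balaban1983to89.B10Eq18SigmaSU2Haar (rev rev_rev coe_expPoint_rev)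
open Literature.MathematicalPhysics.QuantumFieldTheory.Balaban1983to89.T3LevelShift (fieldShift bondShift)
open Literature.MathematicalPhysics.QuantumLattice (fundamentalRep fundamentalRep_apply)
open Literature.Algebra.Lie.CompactKillingForm (su mem_su_iff)
open Summit.QuantumFields.YangMills.Theorems.FluctuationComparisonRegPrIntLS2BetaChartReadDescentOnto (continuousAt_iter_chart)
open Summit.QuantumFields.YangMills.Theorems.FluctuationComparisonRegPrIntLS2BetaChartReadDescentOntoT3

/-! ## §1 The quaternionic chart IS the log chart's exponential in Pauli coordinates -/

section Bridge

/-- The reversed Pauli coordinate of a vector lies in `𝔰𝔲(2) = C.lie` of the `SU(2)` log chart (`su2Coord_mem_su` read through `mem_su_iff` ∕ `mem_specialUnitaryLogChart_lie`;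
the un-reversed form is lit `B10Eq18SigmaSU2Chart.su2Coord_mem_lie`). [cite: Balaban1985UV3, p. 260] -/
theorem su2Coord_rev_mem_lie (x : EuclideanSpace ℝ (Fin 3)) : su2Coord (rev x) ∈ (specialUnitaryLogChart (Fin 2)).lie := by
  rw [mem_specialUnitaryLogChart_lie, Matrix.star_eq_conjTranspose]
  exact mem_su_iff.1 (su2Coord_mem_su _)

/-- **`expPoint x = Θ(iΣ_a (rev x)^a σ_a)`**: the quaternionic chart point of lit `T4HaarSU2ExpChart` is the exponential chart of `isChartRep_specialUnitaryGroup (n := Fin 2)`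
at the Pauli coordinates of the reversed vector (`coe_expPoint_rev`, `rev_rev`, `rho_expChart`). [cite: Balaban1985UV3, p. 260] -/
theorem expPoint_eq_expChart (x : EuclideanSpace ℝ (Fin 3)) :
    expPoint x = (isChartRep_specialUnitaryGroup (n := Fin 2)).expChart ⟨su2Coord (rev x), su2Coord_rev_mem_lie x⟩ := by
  apply (isChartRep_specialUnitaryGroup (n := Fin 2)).injective
  rw [(isChartRep_specialUnitaryGroup (n := Fin 2)).rho_expChart, fundamentalRep_apply]
  show ((expPoint x : SU 2) : Matrix (Fin 2) (Fin 2) ℂ) = NormedSpace.exp (su2Coord (rev x))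
  rw [← coe_expPoint_rev, rev_rev]

/-- Field level: the right-invariant quaternionic chart `ℓ ↦ expPoint(ζ ℓ)·U₀ ℓ` is N09's translated product chart `b ↦ Θ(A b)·U₀ b` at `A b = ⟨su2Coord (rev (ζ b)), _⟩`.
[cite: Balaban1985UV3, p. 260; Balaban1987RG1, (0.4) p.253 (bookkeeping)] -/
theorem piExpPoint_translate_eq {P : Params} {j : ℕ} (U₀ : GaugeField P j (SU 2)) (ζ : PBond P j → EuclideanSpace ℝ (Fin 3)) :
    (fun ℓ => expPoint (ζ ℓ) * U₀ ℓ : GaugeField P j (SU 2)) =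
      fun b => (isChartRep_specialUnitaryGroup (n := Fin 2)).expChart
        (⟨su2Coord (rev (ζ b)), su2Coord_rev_mem_lie (ζ b)⟩ : (specialUnitaryLogChart (Fin 2)).lie) * U₀ b := by
  funext b
  rw [expPoint_eq_expChart]

/-- **THE BOND-WISE COORDINATE `ℝ³ ≅ 𝔰𝔲(2)` IS A CONTINUOUS LINEAR EQUIVALENCE OF CHART SPACES**: there is `E : (PBond P j → ℝ³) ≃L[ℝ] (PBond P j → 𝔰𝔲(2))` with
`E ζ b = ⟨su2Coord (rev (ζ b)), _⟩` (bond-wise: the isometry `rev`, then `WithLp.linearEquiv`, then the Pauli bijection `su2Coord` onto `C.lie` — `su2Coord_injective`,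
`exists_su2Coord_eq`). [cite: Balaban1985UV3, p. 260] -/
theorem exists_coordEquiv (P : Params) (j : ℕ) :
    ∃ E : (PBond P j → EuclideanSpace ℝ (Fin 3)) ≃L[ℝ] (PBond P j → (specialUnitaryLogChart (Fin 2)).lie),
      ∀ (ζ : PBond P j → EuclideanSpace ℝ (Fin 3)) (b : PBond P j),
        E ζ b = (⟨su2Coord (rev (ζ b)), su2Coord_rev_mem_lie (ζ b)⟩ : (specialUnitaryLogChart (Fin 2)).lie) := by
  have hmem : ∀ x : Fin 3 → ℝ, su2Coord x ∈ (specialUnitaryLogChart (Fin 2)).lie := fun x => by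
    rw [mem_specialUnitaryLogChart_lie, Matrix.star_eq_conjTranspose]; exact mem_su_iff.1 (su2Coord_mem_su _)
  let eₗ : (Fin 3 → ℝ) →ₗ[ℝ] (specialUnitaryLogChart (Fin 2)).lie :=
    { toFun := fun x => ⟨su2Coord x, hmem x⟩
      map_add' := fun x y => Subtype.ext (congrArg Subtype.val (su2Coordₗ.map_add x y))
      map_smul' := fun c x => Subtype.ext (congrArg Subtype.val (su2Coordₗ.map_smul c x)) }
  have hinj : Function.Injective eₗ := fun x y hxy => su2Coord_injective (congrArg Subtype.val hxy)
  have hsurj : Function.Surjective eₗ := fun X => by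
    have hX : (X : Matrix (Fin 2) (Fin 2) ℂ) ∈ su (Fin 2) := by
      have h2 := mem_specialUnitaryLogChart_lie.1 X.2
      rw [Matrix.star_eq_conjTranspose] at h2
      exact mem_su_iff.2 h2
    obtain ⟨x, hx⟩ := exists_su2Coord_eq hX
    exact ⟨x, Subtype.ext hx⟩
  let e : EuclideanSpace ℝ (Fin 3) ≃L[ℝ] (specialUnitaryLogChart (Fin 2)).lie :=
    (rev.toLinearEquiv.trans ((WithLp.linearEquiv 2 ℝ (Fin 3 → ℝ)).trans (LinearEquiv.ofBijective eₗ ⟨hinj, hsurj⟩))).toContinuousLinearEquiv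
  have he : ∀ x : EuclideanSpace ℝ (Fin 3), e x = ⟨su2Coord (rev x), su2Coord_rev_mem_lie x⟩ := fun x => rfl
  refine ⟨ContinuousLinearEquiv.piCongrRight fun _ : PBond P j => e, fun ζ b => ?_⟩
  exact he (ζ b)

end Bridge

/-! ## §2 (s1) ∧ (s2) for the door's `Mc` -/

section Organ

variable {F : T3Family}

/-- `Mc = Mc_log ∘ (ζ ↦ (b ↦ ⟨su2Coord (rev (ζ b)), _⟩))`: the door's charted descent is FILE B's log-chart descent after the bond-wise coordinate.
[cite: Balaban1985UV3, p. 260; Balaban1987RG1, (0.11) p.253 (bookkeeping)] -/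
theorem chartRead_descendTo_expPoint_eq_comp {J K : ℕ} (hJK : J ≤ K) (U₀ : GaugeField (F.P K) 0 (SU 2)) :
    (fun (ζ : PBond (F.P K) 0 → EuclideanSpace ℝ (Fin 3)) (B : PBond (F.P J) 0) =>
        (isChartRep_specialUnitaryGroup (n := Fin 2)).logChart
          (descendTo F ℰp J K hJK (fun ℓ => expPoint (ζ ℓ) * U₀ ℓ) B * (descendTo F ℰp J K hJK U₀ B)⁻¹)) =
      (fun (A : PBond (F.P K) 0 → (specialUnitaryLogChart (Fin 2)).lie) (B : PBond (F.P J) 0) =>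
          (isChartRep_specialUnitaryGroup (n := Fin 2)).logChart
            (descendTo F ℰp J K hJK (fun b => (isChartRep_specialUnitaryGroup (n := Fin 2)).expChart (A b) * U₀ b) B *
              (descendTo F ℰp J K hJK U₀ B)⁻¹)) ∘
        (fun (ζ : PBond (F.P K) 0 → EuclideanSpace ℝ (Fin 3)) (b : PBond (F.P K) 0) =>
          (⟨su2Coord (rev (ζ b)), su2Coord_rev_mem_lie (ζ b)⟩ : (specialUnitaryLogChart (Fin 2)).lie)) := by
  funext ζ
  simp only [Function.comp_apply]
  rw [piExpPoint_translate_eq]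

/-- `Mc 0 = 0`. [cite: Balaban1987RG1, (0.11) p.253 (bookkeeping)] -/
theorem chartRead_descendTo_expPoint_apply_zero {J K : ℕ} (hJK : J ≤ K) (U₀ : GaugeField (F.P K) 0 (SU 2)) :
    (fun (B : PBond (F.P J) 0) =>
        (isChartRep_specialUnitaryGroup (n := Fin 2)).logChart
          (descendTo F ℰp J K hJK (fun ℓ => expPoint ((0 : PBond (F.P K) 0 → EuclideanSpace ℝ (Fin 3)) ℓ) * U₀ ℓ) B *
            (descendTo F ℰp J K hJK U₀ B)⁻¹)) = 0 := by
  have h0 : (fun ℓ => expPoint ((0 : PBond (F.P K) 0 → EuclideanSpace ℝ (Fin 3)) ℓ) * U₀ ℓ : GaugeField (F.P K) 0 (SU 2)) = U₀ := by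
    funext ℓ; rw [Pi.zero_apply, expPoint_zero, one_mul]
  rw [h0]
  funext B
  rw [mul_inv_cancel, Pi.zero_apply]
  exact BalabanUVNodes.N09AveragingOpenAtSmallFields.logChart_one

/-- ★★★ (i) in the door's chart: `Mc` is `C^∞` at `0` for every good history (guard only). [cite: Balaban1987RG1, (0.4) p.253 («analytic function»), (0.11) p.253; Balaban1985UV3, (7) p.257, p.260] -/
theorem contDiffAt_chartRead_descendTo_expPoint {J K : ℕ} (hJK : J ≤ K) {θ : ℕ → ℝ} (hθ0 : ∀ i, 0 ≤ θ i)
    (hθδ : ∀ i, J < i → i ≤ K → (((5 * F.L : ℕ) : ℝ) ^ 2 / 4) * θ i < deltaSU (Fin 2))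
    {U₀ : GaugeField (F.P K) 0 (SU 2)} (hUg : U₀ ∈ histGood F ℰp θ K J) :
    ContDiffAt ℝ ⊤ (fun (ζ : PBond (F.P K) 0 → EuclideanSpace ℝ (Fin 3)) (B : PBond (F.P J) 0) =>
        (isChartRep_specialUnitaryGroup (n := Fin 2)).logChart
          (descendTo F ℰp J K hJK (fun ℓ => expPoint (ζ ℓ) * U₀ ℓ) B * (descendTo F ℰp J K hJK U₀ B)⁻¹)) 0 := by
  obtain ⟨E, hE⟩ := exists_coordEquiv (F.P K) 0
  have hEfun : (fun (ζ : PBond (F.P K) 0 → EuclideanSpace ℝ (Fin 3)) (b : PBond (F.P K) 0) =>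
      (⟨su2Coord (rev (ζ b)), su2Coord_rev_mem_lie (ζ b)⟩ : (specialUnitaryLogChart (Fin 2)).lie)) = ⇑E := by
    funext ζ b; exact (hE ζ b).symm
  rw [chartRead_descendTo_expPoint_eq_comp (F := F) hJK U₀, hEfun]
  have hlog := contDiffAt_chartRead_descendTo (F := F) hJK hθ0 hθδ hUg
  have hE0 : E 0 = 0 := map_zero E
  have hlog' : ContDiffAt ℝ ⊤ (fun (A : PBond (F.P K) 0 → (specialUnitaryLogChart (Fin 2)).lie) (B : PBond (F.P J) 0) =>
      (isChartRep_specialUnitaryGroup (n := Fin 2)).logChart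
        (descendTo F ℰp J K hJK (fun b => (isChartRep_specialUnitaryGroup (n := Fin 2)).expChart (A b) * U₀ b) B *
          (descendTo F ℰp J K hJK U₀ B)⁻¹)) (E 0) := by rw [hE0]; exact hlog
  have hEd : ContDiffAt ℝ ⊤ (⇑E) 0 :=
    (ContinuousLinearEquiv.contDiff (𝕜 := ℝ) (n := ⊤) (E := PBond (F.P K) 0 → EuclideanSpace ℝ (Fin 3))
      (F := PBond (F.P K) 0 → (specialUnitaryLogChart (Fin 2)).lie) E).contDiffAt
  exact hlog'.comp 0 hEd

/-- ★★★ **(s1) ∧ (s2) FOR THE DOOR'S `Mc`**: for every good history `U₀ ∈ histGood F ℰp θ K J`, under the displayed numerics `0 ≤ θ`, `(5L)²∕4·θ_i ≤ α` (`J < i ≤ K`),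
`α ≤ 1∕24`, `α < δ_{SU(2)}`, `157·α < L⁻²`: **`HasStrictFDerivAt Mc (fderiv ℝ Mc 0) 0 ∧ Function.Surjective (fderiv ℝ Mc 0)`** for
`Mc ζ B = Λ(descendTo F ℰp J K hJK (ℓ ↦ expPoint (ζ ℓ)·U₀ ℓ) B · (descendTo F ℰp J K hJK U₀ B)⁻¹)` — the `hMc`∕`hsurj` inputs of ✓`…S2BetaCritMOfSubmersion.exists_multiplier_of_subm`
with `Y := PBond (F.P J) 0 → 𝔰𝔲(2)`, `DM := fderiv ℝ Mc 0`. [cite: Balaban1987RG1, (0.4), (0.8), (0.11) p.253; Balaban1985Averaging, Prop. 3 (122)-(124) p.36; Balaban1985Variational, (3) p.278, (44) p.285; Balaban1985UV3, (7) p.257, p.260] -/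
theorem hasStrictFDerivAt_chartRead_descendTo_expPoint {J K : ℕ} (hJK : J ≤ K) {θ : ℕ → ℝ} (hθ0 : ∀ i, 0 ≤ θ i) {α : ℝ}
    (hθα : ∀ i, J < i → i ≤ K → (((5 * F.L : ℕ) : ℝ) ^ 2 / 4) * θ i ≤ α)
    (hα24 : α ≤ 1 / 24) (hαδ : α < deltaSU (Fin 2)) (hαL : 157 * α < ((F.L : ℝ) ^ 2)⁻¹)
    {U₀ : GaugeField (F.P K) 0 (SU 2)} (hUg : U₀ ∈ histGood F ℰp θ K J) :
    HasStrictFDerivAt (fun (ζ : PBond (F.P K) 0 → EuclideanSpace ℝ (Fin 3)) (B : PBond (F.P J) 0) =>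
        (isChartRep_specialUnitaryGroup (n := Fin 2)).logChart
          (descendTo F ℰp J K hJK (fun ℓ => expPoint (ζ ℓ) * U₀ ℓ) B * (descendTo F ℰp J K hJK U₀ B)⁻¹))
      (fderiv ℝ (fun (ζ : PBond (F.P K) 0 → EuclideanSpace ℝ (Fin 3)) (B : PBond (F.P J) 0) =>
        (isChartRep_specialUnitaryGroup (n := Fin 2)).logChart
          (descendTo F ℰp J K hJK (fun ℓ => expPoint (ζ ℓ) * U₀ ℓ) B * (descendTo F ℰp J K hJK U₀ B)⁻¹)) 0) 0 ∧
    Function.Surjective (fderiv ℝ (fun (ζ : PBond (F.P K) 0 → EuclideanSpace ℝ (Fin 3)) (B : PBond (F.P J) 0) =>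
        (isChartRep_specialUnitaryGroup (n := Fin 2)).logChart
          (descendTo F ℰp J K hJK (fun ℓ => expPoint (ζ ℓ) * U₀ ℓ) B * (descendTo F ℰp J K hJK U₀ B)⁻¹)) 0) := by
  have hθδ : ∀ i, J < i → i ≤ K → (((5 * F.L : ℕ) : ℝ) ^ 2 / 4) * θ i < deltaSU (Fin 2) :=
    fun i hi hiK => lt_of_le_of_lt (hθα i hi hiK) hαδ
  refine ⟨(contDiffAt_chartRead_descendTo_expPoint (F := F) hJK hθ0 hθδ hUg).hasStrictFDerivAt (by simp), ?_⟩
  obtain ⟨E, hE⟩ := exists_coordEquiv (F.P K) 0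
  have hEfun : (fun (ζ : PBond (F.P K) 0 → EuclideanSpace ℝ (Fin 3)) (b : PBond (F.P K) 0) =>
      (⟨su2Coord (rev (ζ b)), su2Coord_rev_mem_lie (ζ b)⟩ : (specialUnitaryLogChart (Fin 2)).lie)) = ⇑E := by
    funext ζ b; exact (hE ζ b).symm
  rw [chartRead_descendTo_expPoint_eq_comp (F := F) hJK U₀, hEfun]
  obtain ⟨hC, hS⟩ := hasStrictFDerivAt_chartRead_descendTo (F := F) hJK hθ0 hθα hα24 hαδ hαL hUg
  set Mlog := fun (A : PBond (F.P K) 0 → (specialUnitaryLogChart (Fin 2)).lie) (B : PBond (F.P J) 0) =>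
      (isChartRep_specialUnitaryGroup (n := Fin 2)).logChart
        (descendTo F ℰp J K hJK (fun b => (isChartRep_specialUnitaryGroup (n := Fin 2)).expChart (A b) * U₀ b) B *
          (descendTo F ℰp J K hJK U₀ B)⁻¹) with hMlog
  have hE0 : E 0 = 0 := map_zero E
  have hMD : HasFDerivAt Mlog (fderiv ℝ Mlog 0) (E 0) := by rw [hE0]; exact hC.hasFDerivAt
  have hED : HasFDerivAt (⇑E) (E : (PBond (F.P K) 0 → EuclideanSpace ℝ (Fin 3)) →L[ℝ] (PBond (F.P K) 0 → (specialUnitaryLogChart (Fin 2)).lie)) 0 :=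
    ContinuousLinearEquiv.hasFDerivAt (𝕜 := ℝ) (E := PBond (F.P K) 0 → EuclideanSpace ℝ (Fin 3))
      (F := PBond (F.P K) 0 → (specialUnitaryLogChart (Fin 2)).lie) (x := 0) E
  have hcomp : HasFDerivAt (Mlog ∘ ⇑E) ((fderiv ℝ Mlog 0).comp (E : (PBond (F.P K) 0 → EuclideanSpace ℝ (Fin 3)) →L[ℝ]
      (PBond (F.P K) 0 → (specialUnitaryLogChart (Fin 2)).lie))) 0 :=
    HasFDerivAt.comp (𝕜 := ℝ) (f := ⇑E) (f' := (E : (PBond (F.P K) 0 → EuclideanSpace ℝ (Fin 3)) →L[ℝ]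
      (PBond (F.P K) 0 → (specialUnitaryLogChart (Fin 2)).lie))) (g := Mlog) (g' := fderiv ℝ Mlog 0)
      (0 : PBond (F.P K) 0 → EuclideanSpace ℝ (Fin 3)) hMD hED
  rw [hcomp.fderiv, ContinuousLinearMap.coe_comp]
  exact hS.comp E.surjective

end Organ

/-! ## §3 The door's two topological inputs: the raw charted descent is continuous at `0`; the relative log chart is injective near the base -/

section DoorInputs

/-- ★ **THE TARGET CHART IS INJECTIVE NEAR THE BASE** (any `P`, `SU(N)`): on the window `{W | ∀ B, ‖↑(W B·(V B)⁻¹) − 1‖ < innerRadius}` the relative log chart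
`W ↦ (B ↦ Λ(W B·(V B)⁻¹))` is injective (`Θ ∘ Λ = id` there, ✓`expChart_logChart`). [cite: Helgason2000, Ch. I §1 Thm. 1.14 (13) p. 96 (bookkeeping)] -/
theorem injOn_relLogChart {P : Params} {j N : ℕ} [NeZero N] (V : GaugeField P j (SU N)) :
    Set.InjOn (fun (W : GaugeField P j (SU N)) (B : PBond P j) => (isChartRep_specialUnitaryGroup (n := Fin N)).logChart (W B * (V B)⁻¹))
      {W | ∀ B, ‖((W B * (V B)⁻¹ : SU N) : Matrix (Fin N) (Fin N) ℂ) - 1‖ < innerRadius (specialUnitaryLogChart (Fin N))} := by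
  intro W hW W' hW' hWW'
  funext B
  have hB := congrFun hWW' B
  have hρ : ‖fundamentalRep (Fin N) (W B * (V B)⁻¹) - 1‖ < innerRadius (specialUnitaryLogChart (Fin N)) := by
    rw [fundamentalRep_apply]; exact hW B
  have hρ' : ‖fundamentalRep (Fin N) (W' B * (V B)⁻¹) - 1‖ < innerRadius (specialUnitaryLogChart (Fin N)) := by
    rw [fundamentalRep_apply]; exact hW' B
  have h1 := (isChartRep_specialUnitaryGroup (n := Fin N)).expChart_logChart hρ
  have h2 := (isChartRep_specialUnitaryGroup (n := Fin N)).expChart_logChart hρ'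
  have h3 : W B * (V B)⁻¹ = W' B * (V B)⁻¹ := by
    rw [← h1, ← h2]; exact congrArg _ hB
  exact mul_right_cancel h3

/-- The window of `injOn_relLogChart` is a neighbourhood of the base `V` (finitely many continuous coordinates, each `0 < innerRadius` at `V`).
[cite: Helgason2000, Ch. I §1 Thm. 1.14 (13) p. 96 (bookkeeping)] -/
theorem relLogChart_window_mem_nhds {P : Params} {j N : ℕ} [NeZero N] (V : GaugeField P j (SU N)) :
    {W : GaugeField P j (SU N) | ∀ B, ‖((W B * (V B)⁻¹ : SU N) : Matrix (Fin N) (Fin N) ℂ) - 1‖ < innerRadius (specialUnitaryLogChart (Fin N))} ∈ 𝓝 V := by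
  rw [Set.setOf_forall]
  refine (Filter.iInter_mem).2 fun B => ?_
  have hc : Continuous fun W : GaugeField P j (SU N) => ‖((W B * (V B)⁻¹ : SU N) : Matrix (Fin N) (Fin N) ℂ) - 1‖ :=
    continuous_norm.comp ((continuous_subtype_val.comp ((continuous_apply B).mul continuous_const)).sub continuous_const)
  have h0 : ‖((V B * (V B)⁻¹ : SU N) : Matrix (Fin N) (Fin N) ℂ) - 1‖ < innerRadius (specialUnitaryLogChart (Fin N)) := by
    rw [mul_inv_cancel, OneMemClass.coe_one, sub_self, norm_zero]; exact innerRadius_pos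
  exact hc.continuousAt.preimage_mem_nhds (isOpen_Iio.mem_nhds h0)

variable {F : T3Family}

/-- ★ **THE RAW CHARTED DESCENT IS CONTINUOUS AT `0`** (the `hcont` input of ✓p823740 `exists_multiplier_of_chart`): for a good history `U₀` (guard only),
`ζ ↦ D_{J,K}(expPoint(ζ)•U₀)` is continuous at `ζ = 0` (FILE A `continuousAt_iter_chart` through the coordinate `E` and the continuous level identification `fieldShift`).
[cite: Balaban1987RG1, (0.4), (0.11) p.253; Balaban1985UV3, (7) p.257] -/
theorem continuousAt_descendTo_expPoint {J K : ℕ} (hJK : J ≤ K) {θ : ℕ → ℝ} (hθ0 : ∀ i, 0 ≤ θ i)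
    (hθδ : ∀ i, J < i → i ≤ K → (((5 * F.L : ℕ) : ℝ) ^ 2 / 4) * θ i < deltaSU (Fin 2))
    {U₀ : GaugeField (F.P K) 0 (SU 2)} (hUg : U₀ ∈ histGood F ℰp θ K J) :
    ContinuousAt (fun ζ : PBond (F.P K) 0 → EuclideanSpace ℝ (Fin 3) =>
      descendTo F ℰp J K hJK (fun ℓ => expPoint (ζ ℓ) * U₀ ℓ : GaugeField (F.P K) 0 (SU 2))) 0 := by
  obtain ⟨E, hE⟩ := exists_coordEquiv (F.P K) 0
  have hfun : (fun ζ : PBond (F.P K) 0 → EuclideanSpace ℝ (Fin 3) =>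
      descendTo F ℰp J K hJK (fun ℓ => expPoint (ζ ℓ) * U₀ ℓ : GaugeField (F.P K) 0 (SU 2))) =
      (fun W : GaugeField (F.P K) (K - J) (SU 2) =>
          fieldShift (F.sitesPerDir_eq (m := F.m) (K := J) (j := 0) (m' := F.m) (K' := K) (j' := K - J) (by omega)) W) ∘
        (fun A : PBond (F.P K) 0 → (specialUnitaryLogChart (Fin 2)).lie =>
          Averaging.iter (fun i => blockAvg (P := F.P K) (j := i) (expMeanLogSU (n := Fin 2))) (K - J)
            (fun b => (isChartRep_specialUnitaryGroup (n := Fin 2)).expChart (A b) * U₀ b)) ∘ ⇑E := by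
    funext ζ
    simp only [Function.comp_apply]
    rw [piExpPoint_translate_eq]
    have hA : (fun b => (isChartRep_specialUnitaryGroup (n := Fin 2)).expChart
        ((⟨su2Coord (rev (ζ b)), su2Coord_rev_mem_lie (ζ b)⟩ : (specialUnitaryLogChart (Fin 2)).lie)) * U₀ b : GaugeField (F.P K) 0 (SU 2)) =
        fun b => (isChartRep_specialUnitaryGroup (n := Fin 2)).expChart (E ζ b) * U₀ b := by
      funext b; rw [hE ζ b]
    rw [hA]
    rfl
  rw [hfun]
  have hshift : Continuous fun W : GaugeField (F.P K) (K - J) (SU 2) =>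
      fieldShift (F.sitesPerDir_eq (m := F.m) (K := J) (j := 0) (m' := F.m) (K' := K) (j' := K - J) (by omega)) W :=
    continuous_pi fun B => continuous_apply _
  have hiter := continuousAt_iter_chart (P := F.P K) (N := 2) U₀ (K - J) (smallBelow_of_histGood (F := F) hθ0 hθδ hUg)
  have hE0 : E 0 = 0 := map_zero E
  have hiter' : ContinuousAt (fun A : PBond (F.P K) 0 → (specialUnitaryLogChart (Fin 2)).lie =>
      Averaging.iter (fun i => blockAvg (P := F.P K) (j := i) (expMeanLogSU (n := Fin 2))) (K - J)
        (fun b => (isChartRep_specialUnitaryGroup (n := Fin 2)).expChart (A b) * U₀ b)) (E 0) := by rw [hE0]; exact hiter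
  have hEc : ContinuousAt (⇑E) 0 :=
    (ContinuousLinearEquiv.continuous (R₁ := ℝ) (M₁ := PBond (F.P K) 0 → EuclideanSpace ℝ (Fin 3))
      (M₂ := PBond (F.P K) 0 → (specialUnitaryLogChart (Fin 2)).lie) E).continuousAt
  exact hshift.continuousAt.comp (hiter'.comp hEc)

end DoorInputs

end Summit.QuantumFields.YangMills.Theorems.FluctuationComparisonRegPrIntLS2BetaChartReadDescentOntoExpPoint

end
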